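import Summits.Ventures.CertifiedManyBodySolver.Downfold.PhaseMapRouterPrimaryCells
import Summits.Ventures.CertifiedManyBodySolver.Downfold.PhaseMapGridResolution
import Summits.Ventures.CertifiedManyBodySolver.Downfold.RouterWordScore

/-!
# The router's insulator default per COLUMN and the §4.5 verdict: the first false negative of the programme (M46)

Venture CertifiedManyBodySolver, cell `pub/hubbard-downfold`, seat hubbard-downfold-score-1 (second scoring engine);
namespace `Summit.Ventures.CertifiedManyBodySolver.Downfold.CellScore`. Context: the assembler's G2 rule (oracle-dag `maps/FORMAT.md`
G2: a `BI` word or a `CI` annotation among a column's router words under a DECIDED primary ⇒ every cell of that column «not»,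
screening-grade, unless a stage hand-in supersedes it; an `UND:<x>` primary ⇒ `router:UND` cells), ACCEPTANCE §3.3 R-2W reading (a)
(v1.8) and the §4.5 material verdict, which reads the cells of EVERY truth P column (H = 0) above one material-level floor. RUN #36
(maps/run-2026-08-27ae, 2026-08-27T10:22Z) carried the first false negative of the programme: M46 κ-(ET)₂Cu₂(CN)₃, router words
«1BH+CI» on all three columns P = 0, 0.4, 0.8 GPa ⇒ 66 default «not» cells; curated truth noSC ≥ 1.4 K at P = 0 but SC 3.3 ± 1.0 K at
0.4 GPa and 2.0 ± 1.5 K at 0.8 GPa ⇒ 8 false-not cells and material verdict NOT on a known superconductor = FN (both engines; downfold-lead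
RULING R-do: «the FN stands as the box's recorded miss — a P-independent CI word cannot carry Mott @0, SC by 0.4 GPa»). This file is the
KERNEL FORM of the mechanics score-1 stated on the cell bus (10:27Z: option (i) per-P words ⇒ ABSTAIN, option (ii) keep ⇒ FN) and of the
pre-registration it added to `tools/words_preview.py` the same hour. Everything is PROVED.

WHAT THIS IS NOT: not the assembler and not a statement about which word is right (the router pen's, ruled R-do) — it fixes what the
letter DOES with a per-column insulator default:

* §1 `colCells` / `matCells`: a material as a list of columns, each governed by its own `Primary` (FORMAT by_P / ACCEPTANCE v1.9 item 9:
  the words in force at that P) over a temperature grid, with no stage hand-in anywhere (the S1-only state of a freshly worded box);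
  `assemblerWord_none_ne_SC` (no default ever writes «SC»), membership lemmas.
* §2 THE DICHOTOMY: `verdict_insulatorDefault_every_column` — the default on EVERY column (and one cell at/above the floor) ⇒ verdict NOT,
  hence `kind_insulatorDefault_every_column` = FN on a known superconductor / TN otherwise (M46 / M13-before-R-y, M58): the verdict cannot
  see at which P the truth superconducts; `verdict_default_with_open_column` — if ANY column with a cell at/above the floor is governed by a
  non-default primary with no hand-in (Hubbard box word pending, e–ph band pending, or UND), the verdict is UNDETERMINED ⇒
  `kind_default_with_open_column` = ABSTAIN for either truth class (option (i): «1BH+CI» @0 only, «1BH» at P > 0); `no_FP_from_defaults`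
  — defaults alone never produce a false positive.
* §3 THE M46 NUMBERS: the two SC columns' tolerances (`tau 3.3 1.0 = 1`, `tau 2.0 1.5 = 3/2`), the false-not cells on the T22 grid
  (5 at 0.4 GPa: T ∈ {0, 0.1, 0.3, 1, 2}; 3 at 0.8 GPa: T ∈ {0, 0.1, 0.3}; `m46_false_not_cells` = 8), `m46_FN` (three default columns over
  T22 with floor 1.4 K ⇒ FN) and `m46_byP_ABSTAIN` (default @0 only ⇒ ABSTAIN); §7 arithmetic of record: decided 5 → 6, differentiation
  5/5 → 5/6 fails the «= 1.00» clause, accuracy screening-grade 134/142 (`run36_counts`).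
-/

namespace Summit.Ventures.CertifiedManyBodySolver.Downfold

namespace CellScore

/-! ## §1 Columns under their own primaries, no stage hand-in -/

/-- The cells of ONE column governed by primary `p` over the temperature grid `Ts`, with no stage hand-in (S1-only state): the
assembler's word per cell (`assemblerWord p .none`). [folklore] -/
def colCells (p : Primary) (Ts : List ℚ) : List (ℚ × Word) :=
  cellsUnder p (Ts.map fun T => (T, Stage.none))

/-- The cells of a material = its columns' cells appended (the §4.5 verdict reads every truth column above one floor and does not
otherwise distinguish P). [folklore] -/
def matCells : List (Primary × List ℚ) → List (ℚ × Word)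
  | [] => []
  | c :: cs => colCells c.1 c.2 ++ matCells cs

/-- No router default and no pending branch ever writes «SC» into a cell: with no stage hand-in the assembler's word is «not»
(insulator default) or «undetermined». [folklore] -/
theorem assemblerWord_none_ne_SC (p : Primary) : assemblerWord p .none ≠ Word.SC := by
  cases p <;> decide

/-- With no hand-in, a column NOT governed by the insulator default reads «undetermined» in every cell. [folklore] -/
theorem assemblerWord_none_of_ne_default {p : Primary} (hp : p ≠ .insulatorDefault) :
    assemblerWord p .none = Word.undetermined := by
  cases p
  · rfl
  · exact absurd rfl hp
  · rfl
  · rfl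

/-- The cells of a column are the grid temperatures paired with the one word the primary dictates. [folklore] -/
theorem colCells_eq (p : Primary) (Ts : List ℚ) : colCells p Ts = Ts.map (fun T => (T, assemblerWord p .none)) := by
  simp only [colCells, cellsUnder, List.map_map]
  rfl

/-- Membership in a column's cells. [folklore] -/
theorem mem_colCells {p : Primary} {Ts : List ℚ} {x : ℚ × Word} :
    x ∈ colCells p Ts ↔ ∃ T ∈ Ts, (T, assemblerWord p .none) = x := by
  rw [colCells_eq, List.mem_map]

/-- Membership in a material's cells: the cell comes from some column. [folklore] -/
theorem mem_matCells {cols : List (Primary × List ℚ)} {x : ℚ × Word} :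
    x ∈ matCells cols ↔ ∃ c ∈ cols, x ∈ colCells c.1 c.2 := by
  induction cols with
  | nil => simp [matCells]
  | cons c cs ih =>
    simp only [matCells, List.mem_append, ih, List.mem_cons]
    constructor
    · rintro (h | ⟨c', hc', hx⟩)
      · exact ⟨c, Or.inl rfl, h⟩
      · exact ⟨c', Or.inr hc', hx⟩
    · rintro ⟨c', (rfl | hc'), hx⟩
      · exact Or.inl hx
      · exact Or.inr ⟨c', hc', hx⟩

/-- Every cell of a material with no hand-ins carries a non-SC word. [folklore] -/
theorem matCells_ne_SC (cols : List (Primary × List ℚ)) : ∀ x ∈ matCells cols, x.2 ≠ Word.SC := by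
  intro x hx
  obtain ⟨c, _, hxc⟩ := mem_matCells.mp hx
  obtain ⟨T, _, rfl⟩ := mem_colCells.mp hxc
  exact assemblerWord_none_ne_SC c.1

/-- Hence `saysSC` is false on such a material (no SC cell, no band). [folklore] -/
theorem saysSC_matCells (cols : List (Primary × List ℚ)) : saysSC (matCells cols) [] = false := by
  rw [Bool.eq_false_iff, Ne, saysSC_eq_true_iff]
  rintro (⟨c, hcm, hcw⟩ | ⟨b, hbm, _⟩)
  · exact matCells_ne_SC cols c hcm hcw
  · simp at hbm

/-! ## §2 The dichotomy: default on every column ⇒ NOT; one open column ⇒ UNDETERMINED -/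

/-- If EVERY column is governed by the insulator default, every cell of the material reads «not». [folklore] -/
theorem matCells_all_not {cols : List (Primary × List ℚ)} (hall : ∀ c ∈ cols, c.1 = Primary.insulatorDefault) :
    ∀ x ∈ matCells cols, x.2 = Word.not := by
  intro x hx
  obtain ⟨c, hc, hxc⟩ := mem_matCells.mp hx
  obtain ⟨T, _, rfl⟩ := mem_colCells.mp hxc
  rw [hall c hc]
  rfl

/-- THE DEFAULT ON EVERY COLUMN: with the insulator default governing every column and at least one cell at or above the material's
floor temperature, the §4.5 verdict is NOT — whatever the truth does at the other pressures. [folklore] -/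
theorem verdict_insulatorDefault_every_column (Tfloor : ℚ) (cols : List (Primary × List ℚ))
    (hall : ∀ c ∈ cols, c.1 = Primary.insulatorDefault) (hne : ∃ c ∈ cols, ∃ T ∈ c.2, Tfloor ≤ T) :
    verdict Tfloor (matCells cols) [] = .NOT := by
  have hNOT : saysNOT Tfloor (matCells cols) [] = true := by
    obtain ⟨c, hc, T, hT, hle⟩ := hne
    have hmem : (T, assemblerWord c.1 .none) ∈ matCells cols := mem_matCells.mpr ⟨c, hc, mem_colCells.mpr ⟨T, hT, rfl⟩⟩
    simp only [saysNOT, relevant, Bool.and_eq_true, Bool.not_eq_true', List.all_eq_true, decide_eq_true_eq, List.any_nil,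
               List.isEmpty_eq_false_iff_exists_mem, List.mem_filter]
    refine ⟨⟨⟨(T, assemblerWord c.1 .none), hmem, by simpa using hle⟩, ?_⟩, trivial⟩
    rintro x ⟨hx, _⟩
    exact matCells_all_not hall x hx
  simp [verdict, saysSC_matCells, hNOT]

/-- … so the confusion entry depends on the truth class ONLY: FN on a known superconductor (M46 κ-(ET)₂Cu₂(CN)₃, RUN #36), TN on a
non-superconductor (M13 La₂CuO₄ before R-y; M58). The verdict cannot see at which pressure the truth superconducts. [folklore] -/
theorem kind_insulatorDefault_every_column (Tfloor : ℚ) (cols : List (Primary × List ℚ))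
    (hall : ∀ c ∈ cols, c.1 = Primary.insulatorDefault) (hne : ∃ c ∈ cols, ∃ T ∈ c.2, Tfloor ≤ T) (isSC : Bool) :
    kind (verdict Tfloor (matCells cols) []) isSC = (if isSC then .FN else .TN) := by
  rw [verdict_insulatorDefault_every_column Tfloor cols hall hne]
  cases isSC <;> rfl

/-- ONE OPEN COLUMN: if some column with a cell at or above the floor is governed by a primary OTHER than the insulator default and
nothing was handed in there (Hubbard box word / thermal certificate pending, e–ph band pending, or an UND primary), that cell reads
«undetermined», so «every relevant cell is not» fails and the §4.5 verdict is UNDETERMINED. This is option (i) of the cell-bus note: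
«1BH+CI» at P = 0 only and «1BH» (no CI) at 0.4 / 0.8 GPa. [folklore] -/
theorem verdict_default_with_open_column (Tfloor : ℚ) (cols : List (Primary × List ℚ))
    (hopen : ∃ c ∈ cols, c.1 ≠ Primary.insulatorDefault ∧ ∃ T ∈ c.2, Tfloor ≤ T) :
    verdict Tfloor (matCells cols) [] = .UNDETERMINED := by
  have hNOT : saysNOT Tfloor (matCells cols) [] = false := by
    obtain ⟨c, hc, hp, T, hT, hle⟩ := hopen
    have hmem : (T, assemblerWord c.1 .none) ∈ matCells cols := mem_matCells.mpr ⟨c, hc, mem_colCells.mpr ⟨T, hT, rfl⟩⟩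
    rw [Bool.eq_false_iff]
    intro hn
    simp only [saysNOT, Bool.and_eq_true, Bool.not_eq_true', List.all_eq_true, decide_eq_true_eq] at hn
    obtain ⟨⟨-, hall⟩, -⟩ := hn
    have hw := hall (T, assemblerWord c.1 .none) (List.mem_filter.mpr ⟨hmem, by simpa using hle⟩)
    rw [assemblerWord_none_of_ne_default hp] at hw
    exact Word.undetermined_ne_not hw
  simp [verdict, saysSC_matCells, hNOT]

/-- … hence ABSTAIN for either truth class: neither the FN nor a TN is recorded. [folklore] -/
theorem kind_default_with_open_column (Tfloor : ℚ) (cols : List (Primary × List ℚ))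
    (hopen : ∃ c ∈ cols, c.1 ≠ Primary.insulatorDefault ∧ ∃ T ∈ c.2, Tfloor ≤ T) (isSC : Bool) :
    kind (verdict Tfloor (matCells cols) []) isSC = .ABSTAIN := by
  rw [verdict_default_with_open_column Tfloor cols hopen]
  cases isSC <;> rfl

/-- Router defaults and pending branches alone can never produce a FALSE POSITIVE (the costliest error): no cell says «SC».
[folklore] -/
theorem no_FP_from_defaults (Tfloor : ℚ) (cols : List (Primary × List ℚ)) (isSC : Bool) :
    kind (verdict Tfloor (matCells cols) []) isSC ≠ .FP :=
  kind_ne_FP_of_noSC (Tfloor := Tfloor) (bands := []) (matCells_ne_SC cols) (by simp) isSC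

/-! ## §3 The M46 numbers (RUN #36, maps/run-2026-08-27ae, v1 table; truth M46.truth.json 4dc0bd23) -/

/-- ACCEPTANCE §2.3 tolerance of the 0.4-GPa column: T_c 3.3 ± 1.0 K ⇒ τ = max(1.0, 1, 0.165) = 1 K. [folklore] -/
theorem m46_tau_04 : tau (33 / 10) 1 = 1 := by norm_num [tau]

/-- … and of the 0.8-GPa column: T_c 2.0 ± 1.5 K ⇒ τ = 3/2 K. [folklore] -/
theorem m46_tau_08 : tau 2 (3 / 2) = 3 / 2 := by norm_num [tau]

/-- At 0.4 GPa the five T22 points 0, 0.1, 0.3, 1, 2 lie below T_c − τ = 2.3 K (or at T = 0): truth SC there, so a default «not»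
DISAGREES (false-not) at each. [folklore] -/
theorem m46_col04_truthSC : ∀ T ∈ ([0, 1 / 10, 3 / 10, 1, 2] : List ℚ), truthSC (33 / 10) 1 T = .SC := by
  intro T hT
  simp only [List.mem_cons, List.mem_nil_iff, or_false] at hT
  rcases hT with rfl | rfl | rfl | rfl | rfl <;> norm_num [truthSC]

/-- … while T = 4 (inside the tolerance [2.3, 4.3]) is truth-unknown (unscored) and T = 6 is «not» (agree). [folklore] -/
theorem m46_col04_edge : truthSC (33 / 10) 1 4 = .unknown ∧ truthSC (33 / 10) 1 6 = .not := by
  constructor <;> norm_num [truthSC]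

/-- At 0.8 GPa the three T22 points 0, 0.1, 0.3 lie below T_c − τ = 0.5 K (or at T = 0): truth SC ⇒ false-not; T = 1 and 2 are
inside the tolerance; T = 4 is «not». [folklore] -/
theorem m46_col08_truthSC : (∀ T ∈ ([0, 1 / 10, 3 / 10] : List ℚ), truthSC 2 (3 / 2) T = .SC) ∧
    truthSC 2 (3 / 2) 1 = .unknown ∧ truthSC 2 (3 / 2) 2 = .unknown ∧ truthSC 2 (3 / 2) 4 = .not := by
  refine ⟨?_, by norm_num [truthSC], by norm_num [truthSC], by norm_num [truthSC]⟩
  intro T hT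
  simp only [List.mem_cons, List.mem_nil_iff, or_false] at hT
  rcases hT with rfl | rfl | rfl <;> norm_num [truthSC]

/-- The default «not» against those truths: 5 + 3 = 8 disagreeing (false-not) cells — the count both engines printed for M46 at
RUN #36 (`outcome .not .SC = .disagree`). [folklore] -/
theorem m46_false_not_cells : outcome Word.not Truth.SC = .disagree ∧ (5 : ℕ) + 3 = 8 := ⟨rfl, rfl⟩

/-- THE EVENT: three columns (P = 0, 0.4, 0.8 GPa) all governed by the insulator default («1BH+CI» at every P), the T22 grid, the
material floor 1.4 K (the P = 0 column's «noSC down to 1.4 K»): verdict NOT on a known superconductor = FN. [folklore] -/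
theorem m46_FN : kind (verdict (14 / 10) (matCells [(Primary.insulatorDefault, T22), (Primary.insulatorDefault, T22),
    (Primary.insulatorDefault, T22)]) []) true = .FN := by
  rw [kind_insulatorDefault_every_column]
  · rfl
  · intro c hc
    simp only [List.mem_cons, List.mem_nil_iff, or_false] at hc
    rcases hc with rfl | rfl | rfl <;> rfl
  · exact ⟨(Primary.insulatorDefault, T22), by simp, 300, by simp [T22], by norm_num⟩

/-- OPTION (i): the default at P = 0 only and the Hubbard branch pending (no box word / certificate yet) at 0.4 and 0.8 GPa ⇒ verdict
UNDETERMINED ⇒ ABSTAIN — no FN and no TN (§4.5 NOT needs every truth column). [folklore] -/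
theorem m46_byP_ABSTAIN : kind (verdict (14 / 10) (matCells [(Primary.insulatorDefault, T22), (Primary.hubbardBranch, T22),
    (Primary.hubbardBranch, T22)]) []) true = .ABSTAIN :=
  kind_default_with_open_column _ _ ⟨(Primary.hubbardBranch, T22), by simp, by decide, 300, by simp [T22], by norm_num⟩ true

/-- The same two shapes on a NON-superconductor: default everywhere ⇒ TN; one open column ⇒ ABSTAIN (the M13 La₂CuO₄ reading under a
decided primary, cf. `PhaseMapRouterPrimaryCells.M13_event` for the UND side). [folklore] -/
theorem default_columns_nonSC :
    kind (verdict (1 / 10) (matCells [(Primary.insulatorDefault, T22)]) []) false = .TN ∧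
      kind (verdict (1 / 10) (matCells [(Primary.insulatorDefault, T22), (Primary.ephBranch, T22)]) []) false = .ABSTAIN := by
  constructor
  · rw [kind_insulatorDefault_every_column]
    · rfl
    · intro c hc
      simp only [List.mem_cons, List.mem_nil_iff, or_false] at hc
      subst hc; rfl
    · exact ⟨(Primary.insulatorDefault, T22), by simp, 300, by simp [T22], by norm_num⟩
  · exact kind_default_with_open_column _ _ ⟨(Primary.ephBranch, T22), by simp, by decide, 300, by simp [T22], by norm_num⟩ false

/-- §7 arithmetic of record, RUN #35 → RUN #36 (v1 table): decided materials 5 → 6 (TP 3, TN 2, FN 0 → 1); the differentiation score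
(TP+TN)/decided = 5/5 → 5/6 no longer meets the clause «= 1.00 with FP = 0» (first failure of that clause); screening-grade cell
accuracy 83/83 → 134/142 (8 disagreeing cells, all on M46; still ≥ the 0.80 floor). [folklore] -/
theorem run36_counts : (3 : ℕ) + 2 + 1 = 6 ∧ (5 : ℚ) / 5 = 1 ∧ (5 : ℚ) / 6 ≠ 1 ∧ (83 : ℕ) + 51 = 134 ∧ (83 : ℕ) + 59 = 142 ∧
    (4 : ℚ) / 5 ≤ 134 / 142 := by
  refine ⟨rfl, by norm_num, by norm_num, rfl, rfl, by norm_num⟩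

end CellScore

end Summit.Ventures.CertifiedManyBodySolver.Downfold

/-! ## §4 APPEND (g10, 2026-08-27T11:1xZ) — «R-AGREE WITH FN»: the §4.2 router score cannot see the P-dependence that decides §4.5

FINDINGS-2026-08-27-g10 O-g10-4 (informational, to the pens): `expected_router_words` and the scored router words are MATERIAL-LEVEL (the
assembler's words at the lowest P, ACCEPTANCE §4.2 / v1.9 R_mat note), while the cells — and hence the §4.5 verdict — are written PER COLUMN
under the words in force at each P (FORMAT by_P; v1.9 item 9). So one material-level word list can score §4.2 **AGREE** while the per-column
defaults it licenses score §4.5 **FN** (M46 at RUN #36), and the SAME material-level list with different words at P > 0 scores AGREE with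
**ABSTAIN**: the router score is constant across column configurations that §4.5 separates. Stated with score-2's kernel `RouterScore.score`
(p462277; heads `bh1`, `ci`, `undLattice`) and §2–§3 above. Nothing here is a defect of either engine (two-engine 0); it is the vocabulary's
resolution: a P-dependent expectation («CI at P = 0 only») is not expressible in sc-truth rev-2/rev-3.
-/

namespace Summit.Ventures.CertifiedManyBodySolver.Downfold

namespace CellScore

open RouterScore in
/-- M46's router reading at RUN #36: words «1BH+CI» vs the typed alternatives «1BH+CI ∣ 1BH ∣ UND:LATTICE» ⇒ §4.2 AGREE (score-2's kernel score,
by `decide`). [folklore] -/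
theorem m46_router_AGREE :
    RouterScore.score [.bh1, .ci] [[.bh1, .ci], [.bh1], [.undLattice]] = .AGREE := by decide

/-- «R-AGREE WITH FN» realised: the material-level word list of M46 scores AGREE while its three CI-default columns score FN (§3 `m46_FN`).
[folklore] -/
theorem m46_AGREE_and_FN :
    RouterScore.score [.bh1, .ci] [[.bh1, .ci], [.bh1], [.undLattice]] = .AGREE ∧
      kind (verdict (14 / 10) (matCells [(Primary.insulatorDefault, T22), (Primary.insulatorDefault, T22),
        (Primary.insulatorDefault, T22)]) []) true = .FN :=
  ⟨m46_router_AGREE, m46_FN⟩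

/-- … and the SAME material-level list (the lowest-P words are «1BH+CI» in both configurations) with the Hubbard branch pending at P > 0 scores
AGREE with ABSTAIN (§3 `m46_byP_ABSTAIN`): §4.2 returns one value on two column configurations that §4.5 separates into FN and ABSTAIN.
[folklore] -/
theorem router_score_blind_to_columns :
    ∃ colsFN colsAB : List (Primary × List ℚ),
      colsFN.head? = colsAB.head? ∧
      RouterScore.score [.bh1, .ci] [[.bh1, .ci], [.bh1], [.undLattice]] = .AGREE ∧
      kind (verdict (14 / 10) (matCells colsFN) []) true = .FN ∧
      kind (verdict (14 / 10) (matCells colsAB) []) true = .ABSTAIN :=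
  ⟨[(Primary.insulatorDefault, T22), (Primary.insulatorDefault, T22), (Primary.insulatorDefault, T22)],
   [(Primary.insulatorDefault, T22), (Primary.hubbardBranch, T22), (Primary.hubbardBranch, T22)],
   rfl, m46_router_AGREE, m46_FN, m46_byP_ABSTAIN⟩

/-- The converse pairing is excluded by §2 for this shape: with NO stage hand-in anywhere the verdict is never SC, so «R-DISAGREE with TP/FP»
cannot arise from router defaults alone — a TP needs a band or an «SC» cell from a stage (`no_FP_from_defaults`, `saysSC_matCells`).
[folklore] -/
theorem defaults_never_positive (Tfloor : ℚ) (cols : List (Primary × List ℚ)) (isSC : Bool) :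
    kind (verdict Tfloor (matCells cols) []) isSC ≠ .TP ∧ kind (verdict Tfloor (matCells cols) []) isSC ≠ .FP := by
  have hv : verdict Tfloor (matCells cols) [] ≠ .SC := by
    intro h
    have := (verdict_eq_SC_iff (Tfloor := Tfloor) (cells := matCells cols) (bands := [])).mp h
    rw [saysSC_matCells] at this
    exact Bool.false_ne_true this
  constructor
  · intro h; apply hv; revert h; cases verdict Tfloor (matCells cols) [] <;> cases isSC <;> simp [kind]
  · exact no_FP_from_defaults Tfloor cols isSC

end CellScore

end Summit.Ventures.CertifiedManyBodySolver.Downfold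

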